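import Summits.Ventures.HSemireg.Pad4FirstOrderModelChecks

/-!
# Venture HSemireg — `Minimal` is necessary in THEOREM L^ζ's model statement (companion of `Pad4FirstOrderModel.lean`, row 716)

HONEST FRAMING. A PROVED sharpness check of the kernel-OPEN obligation `TheoremLZetaMain` ∕ `TheoremLZeta` of
`Pad4FirstOrderModel.lean` (p505821; typer lineage hodge-lit-semireg-typer g7, 2026-08-27): the model file's FAITHFULNESS (c)
says in words «`Minimal` (PAD4-FIRSTORDER §0 «minimal presentation, no isomorphism entries») is a hypothesis: without it the
sentence is false (pad `E₊`, `E₋` with a cancelling pair of one multi-factor class)» (numerically confirmed by s4-ref-2 g7,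
verdict 9cc08365447960d7; referee KILL-criterion C4 of REF-CRITERIA-fileA-ref-g14.md «Minimal must guard BOTH TheoremLZeta AND
main»). Here that sentence is a kernel theorem: `exists_nonMinimal_classY_H2` — a class-y design (`#N = #P + 4`) with a
constituent charged on two factors, NOT minimal, satisfying `H2` = (E1) at every `κ`. The witness is `E₋ = X ⊕ O⁴`, `E₊ = X`,
`X = ℓ₁^{(0)} + ℓ₁^{(1)}` (layer `0`), with the single entry `φ_{XX} = 1 ∈ H⁰(X − X) = ℂ` (an isomorphism entry, forbidden
by `Minimal`); at every `κ` the unknown `η_X := ob_κ(X)` solves the `X`-column of `φ ∘ η = ob_κ(E₋)` and the `X`-row of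
`η′ ∘ φ = ob_κ(E₊)`, the `O`-columns have no demand (`ob_κ(O) = 0`) and the `O`-rows no entries (`H⁰(O − X) = 0`)
(`H2_isoPadded`, stated for any `X` and any padding constituent `U` uncharged on a factor where `X` is charged). CONSEQUENCE
FOR READERS: the hypothesis `Minimal` cannot be dropped from `TheoremLZetaMain` ∕ `TheoremLZeta`. Nothing here bears on
their truth WITH `Minimal` (kernel-OPEN, `@[conjecture]`); nothing is TIER 2 (director-hodge g7 l.29811 «NOT now»); nothing
here says HC ∕ HC_CM ∕ HC_AV holds; no fact, no definition, no instance, no notation. Imports the row-731 companion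
(`rel_self`). SOURCES as in the model file (PAD4-FIRSTORDER v1.1 93f71c42cb445756 §0; PAD4-THEOREM-L v1.2 66fb170a6cb906b7).
Typed ≠ proved ≠ endorsed.
-/

noncomputable section
namespace Summit.Ventures.HSemireg.Pad4FirstOrder
open Finset

/-- the class `X − X` is `0` on all four factors, as a function. -/
theorem rel_self_fun (X : Constituent) : rel X X = fun _ => Rel.zero := funext (rel_self X)

/-- the product `H²(0) × H⁰(0) → H²(0)` (unknown of class `0` times a constant section) is the identity matrix. -/
theorem coefProd_zero_zero (q : Fin 4 → ℕ) (ι a o : Fin 4 → ℕ × ℕ) :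
    coefProd (fun _ => Rel.zero) (fun _ => Rel.zero) q ι a o = if o = ι then 1 else 0 := by
  unfold coefProd
  by_cases h : o = ι
  · subst h; simp [coef]
  · rw [if_neg h]
    obtain ⟨g, hg⟩ := Function.ne_iff.mp h
    exact Finset.prod_eq_zero (Finset.mem_univ g) (by simp [coef, hg])

/-- `H⁰(X − X) = ℂ`: one section coordinate, the constant. -/
theorem idxH0_self (X : Constituent) : idxH0 X X = {fun _ => ((0 : ℕ), (0 : ℕ))} := by
  unfold idxH0
  rw [rel_self_fun]
  exact Fintype.piFinset_singleton _

/-- an uncharged constituent has no demand: `ob_κ(O) = 0`. -/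
theorem ob_eq_zero_of_uncharged (X : Constituent) (hX : ∀ g, X.charge g = 0) (κ : Matrix (Fin 4) (Fin 4) ℂ)
    (q : Fin 4 → ℕ) (o : Fin 4 → ℕ × ℕ) : ob X κ q o = 0 := by
  unfold ob
  exact Finset.sum_eq_zero fun f _ => Finset.sum_eq_zero fun τ _ => by rw [hX f]; simp

/-- the diagonal block of a system whose section is the constant `1 ∈ H⁰(X − X)` reads off the unknown. -/
theorem sum_diag_block (X : Constituent) (F : (Fin 4 → ℕ) → (Fin 4 → ℕ × ℕ) → ℂ)
    (t : (Fin 4 → ℕ) × (Fin 4 → ℕ × ℕ)) (ht : t ∈ idxH2 X X) :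
    ∑ u ∈ idxH2 X X, ∑ a ∈ idxH0 X X,
      (if u.1 = t.1 then coefProd (rel X X) (rel X X) t.1 u.2 a t.2 else 0) * 1 * F u.1 u.2 = F t.1 t.2 := by
  rw [idxH0_self, rel_self_fun]
  simp only [Finset.sum_singleton, coefProd_zero_zero, mul_one]
  rw [Finset.sum_eq_single_of_mem t ht]
  · simp
  · intro u _ hu
    by_cases h1 : u.1 = t.1
    · have h2 : t.2 ≠ u.2 := fun h2 => hu (Prod.ext h1 h2.symm)
      rw [if_pos h1, if_neg h2, zero_mul]
    · rw [if_neg h1, zero_mul]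

/-- no sections from a constituent charged on `g` to one uncharged on `g`: `H⁰(U − X) = 0`. -/
theorem idxH0_eq_empty_of_uncharged (U X : Constituent) (g : Fin 4) (hU : U.charge g = 0) (hX : X.charge g ≠ 0) :
    idxH0 U X = ∅ := by
  unfold idxH0
  apply Fintype.piFinset_eq_empty.mpr ⟨g, ?_⟩
  unfold rel
  split_ifs <;> simp_all [idx]

/-- **the padded design passes (E1)**: for ANY constituent `X` and any constituent `U` uncharged on a factor where `X` is
charged, the design `E₋ = X ⊕ U⁴`, `E₊ = X` with the single non-zero entry `φ_{XX} = 1 ∈ H⁰(X − X)` (an isomorphism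
entry) satisfies `H2`: at every `κ` take `η_X := ob_κ(X)` and all other unknowns `0`. -/
theorem H2_isoPadded (X U : Constituent) (g₀ : Fin 4) (hU : ∀ g, U.charge g = 0) (hX : X.charge g₀ ≠ 0) :
    (Design.mk [X, U, U, U, U] [X]).H2 (fun i _ _ => if i.val = 0 then 1 else 0) := by
  have hUX : idxH0 U X = ∅ := idxH0_eq_empty_of_uncharged U X g₀ (hU g₀) hX
  have hN0 : ∀ h, (Design.mk [X, U, U, U, U] [X]).N ⟨0, h⟩ = X := fun _ => rfl
  have hNs : ∀ (k : ℕ) (hk : k + 1 < (Design.mk [X, U, U, U, U] [X]).nN),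
      (Design.mk [X, U, U, U, U] [X]).N ⟨k + 1, hk⟩ = U := by
    intro k hk
    have hk4 : k < 4 := by have : k + 1 < 5 := hk; omega
    interval_cases k <;> rfl
  have hj0 : ∀ j : Fin (Design.mk [X, U, U, U, U] [X]).nP, j = ⟨0, Nat.one_pos⟩ := by
    intro j; ext; have : j.val < 1 := j.isLt; simp only; omega
  have hP : ∀ j : Fin (Design.mk [X, U, U, U, U] [X]).nP, (Design.mk [X, U, U, U, U] [X]).P j = X := by
    intro j; rw [hj0 j]; rfl
  intro κ
  constructor
  · intro i
    rcases i with ⟨_ | k, hi⟩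
    · -- the column of `X`: `η_X := ob_κ(X)`
      refine ⟨fun _ q o => ob X κ q o, fun r t ht => ?_⟩
      rcases r with ⟨_ | k', hr⟩
      · -- the demand row `X`: `1 · η_X = ob_κ(X)`
        rw [if_pos rfl]
        simp only [Design.lowerLHS, hN0, hP, if_true]
        rw [Finset.sum_const, Finset.card_univ, Fintype.card_fin]
        show 1 • _ = _
        rw [one_smul]
        exact sum_diag_block X (fun q o => ob X κ q o) t ht
      · -- the rows `U`: no entry `X → U`, empty sum
        rw [if_neg (fun h => by cases h)]
        simp only [Design.lowerLHS, hNs, hP, hUX, Finset.sum_empty, Finset.sum_const_zero]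
    · -- the columns `U`: no demand (`ob_κ(U) = 0`), all unknowns `0`
      refine ⟨fun _ _ _ => 0, fun r t ht => ?_⟩
      have lhs0 : (Design.mk [X, U, U, U, U] [X]).lowerLHS (fun i _ _ => if i.val = 0 then 1 else 0)
          (fun _ _ _ => 0) ⟨k + 1, hi⟩ r t = 0 := by
        simp [Design.lowerLHS]
      rw [lhs0]
      split_ifs with h
      · rw [hNs]; exact (ob_eq_zero_of_uncharged U hU κ _ _).symm
      · rfl
  · intro j
    refine ⟨fun i q o => if i.val = 0 then ob X κ q o else 0, fun s _ t ht => ?_⟩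
    have hs : s = j := by rw [hj0 s, hj0 j]
    rw [if_pos hs]
    simp only [Design.upperLHS, hP]
    rw [Finset.sum_eq_single_of_mem (⟨0, Nat.succ_pos 4⟩ : Fin (Design.mk [X, U, U, U, U] [X]).nN)
      (Finset.mem_univ _) ?_]
    · simp only [hN0, if_true]
      have ht' : t ∈ idxH2 X X := by simpa [hP] using ht
      exact sum_diag_block X (fun q o => ob X κ q o) t ht'
    · intro i _ hi0
      have hiv : i.val ≠ 0 := fun h => hi0 (Fin.ext h)
      simp [hiv]

/-- **`Minimal` IS NECESSARY** (the model file's FAITHFULNESS (c) «without it the sentence is false (pad `E₊`, `E₋` with a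
cancelling pair of one multi-factor class)», numerically confirmed by s4-ref-2 g7; referee KILL-criterion C4 of
REF-CRITERIA-fileA-ref-g14.md): the design `E₋ = X ⊕ O⁴`, `E₊ = X` with `X = ℓ₁^{(0)} + ℓ₁^{(1)}` (layer `0`, charge `1`
and phase `1` on the factors `0, 1`) and the isomorphism entry `φ_{XX} = 1` is of class y (`#N = #P + 4`), has a constituent
charged on `2` factors, is NOT minimal, and satisfies `H2`. Hence the hypothesis `Minimal` cannot be dropped from
`TheoremLZetaMain` ∕ `TheoremLZeta`; nothing here bears on their truth WITH `Minimal` (kernel-OPEN). -/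
theorem exists_nonMinimal_classY_H2 :
    ∃ (D : Design) (φ : D.Sections), D.InClassY ∧ (∃ X ∈ D.lower ++ D.upper, 2 ≤ X.nCharged) ∧
      ¬ D.Minimal φ ∧ D.H2 φ := by
  refine ⟨Design.mk [⟨0, fun g => if g.val < 2 then 1 else 0, fun _ => 0⟩, ⟨0, fun _ => 0, fun _ => 0⟩,
      ⟨0, fun _ => 0, fun _ => 0⟩, ⟨0, fun _ => 0, fun _ => 0⟩, ⟨0, fun _ => 0, fun _ => 0⟩]
      [⟨0, fun g => if g.val < 2 then 1 else 0, fun _ => 0⟩],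
    fun i _ _ => if i.val = 0 then 1 else 0, rfl, ⟨⟨0, fun g => if g.val < 2 then 1 else 0, fun _ => 0⟩, by simp, ?_⟩,
    ?_, H2_isoPadded _ _ 0 (fun _ => rfl) (by simp)⟩
  · -- charged on the two factors `0, 1`
    unfold Constituent.nCharged
    decide
  · -- not minimal: `φ_{XX} = 1` is an isomorphism entry
    intro hmin
    have h := hmin ⟨0, Nat.succ_pos 4⟩ ⟨0, Nat.one_pos⟩ (fun g => rel_self _ g) fun _ => (0, 0)
    simp at h

end Summit.Ventures.HSemireg.Pad4FirstOrder

end
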